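import Summits.Ventures.HodgeRepro2.T6N41PlaceLCMain
import Summits.Ventures.HodgeRepro2.T6N41PlaceSatakeToy

/-!
# T6N41PlaceLCToy — the Langlands-class cut instantiated (Tier 6, M2; proof lane; owner t6-p4)

Three instances of `LCDatum` (README §10.5(ii)(c)/(d)), on the same datums as T6N41PlaceSatakeToy:
* the IS toy (`S = ∅`, inert prime `0`): `unr ≡ True`, `lc ≡ rep (−1)` (the Langlands class of the toy's `π_v`,
  the constituent of `I(χ)` with `χ(ϖ) = −1`), `BC = (−1, (−1)⁻¹)`; the display Getz–Hahn §7.5–7.6 holds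
  NON-vacuously (`JH 𝔓 a ≠ ∅` only for `a = −1`, conjugator `s = 1`); the reading `BC_lc` is PROVED on the toy by
  the kernel algebra `eq_neg_one_of_twisted_conj_rep_neg_one` (a representative `s · rep a · σ(s)⁻¹` of the
  class of `rep (−1)` forces `a = −1`) — not by a guard; `inertDatum_of_lc … = toyInIS` by `rfl`;
* the universal chain (`univIn D hS`): `unr ρ := ρ.2 = ρ.1⁻¹`, `lc ρ := rep ρ.1`, the same `BC`; the display by
  computation (`ρ ∈ JH 𝔓 a` means `ρ = (a, a⁻¹)`, so `lc ρ = rep a`, `s = 1`), `BC_lc` by the same algebra;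
  `inertDatum_of_lc … = univIn D hS` by `rfl`; the placement composes (`univ_placement_kappa_lc`);
* `toyD41` / `N43Toy.bergmanNSide.d41`: the v8 slots `d41LC`, `d41_GH`, and the compositions.

`#print axioms` = {propext, Classical.choice, Quot.sound}.

§8(d): uses an L-value-free non-vanishing device: NO.
-/

namespace Summit.Ventures.HodgeRepro2.T6

open N41LGroup (rep sigmaΦ sigmaΦ_one matrix_inv_one eq_neg_one_of_twisted_conj_rep_neg_one)

/-- `1 · g · σ(1)⁻¹ = g`: the trivial conjugator. -/
theorem one_twisted_conj (g : Matrix (Fin 2) (Fin 2) ℂ) : (1 : Matrix (Fin 2) (Fin 2) ℂ) * g * (sigmaΦ 1)⁻¹ = g := by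
  rw [sigmaΦ_one, matrix_inv_one, Matrix.one_mul, Matrix.mul_one]

/-! ### The IS toy -/

namespace N41PlaceToy

/-- The Langlands-class carriers on the IS toy's core: every representation unramified, every Langlands class
that of `rep (−1)`, LR's `BC(π_v) = (−1, (−1)⁻¹)`; `BC_lc` PROVED by the kernel algebra. -/
@[reducible] noncomputable def toyLCIS : LCDatum toyInIS.toData where
  unr := fun _ _ => True
  π_unr := fun _ _ _ => trivial
  lc := fun _ _ => rep (-1)
  BC := fun _ => (-1, (-1)⁻¹)
  BCχ_def := fun 𝔓 h => by
    have h0 : 𝔓 = 0 := h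
    subst h0
    simp [InertDatum.toData, toyInIS, toyPlIS]
  BC_lc := fun _ _ _ a s hs hl => by
    have ha : a = -1 := eq_neg_one_of_twisted_conj_rep_neg_one a s hs hl.symm
    subst ha
    exact Or.inl rfl

/-- Getz–Hahn §7.5–7.6 on the IS toy, NOT vacuous: `JH 𝔓 a ≠ ∅` only for `a = −1`, and then `lc ρ = rep (−1) =
1 · rep (−1) · σ(1)⁻¹`. -/
theorem toyIS_GH : Hyp.GetzHahn2024_Prop7_6_5 toyLCIS := by
  intro 𝔓 _ a ρ _ ha
  change ρ ∈ (if a = -1 then (Set.univ : Set (ℂˣ × ℂˣ)) else ∅) at ha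
  by_cases h : a = -1
  · subst h
    exact ⟨1, by simp, (one_twisted_conj _).symm⟩
  · rw [if_neg h] at ha
    exact ha.elim

/-- The inert datum rebuilt from the core and the Langlands-class carriers is the landed `toyInIS`. -/
theorem toyIS_inertDatum_of_lc_eq :
    N41Place.inertDatum_of_lc toyInIS.toData toyLCIS toyIS_GH toyIS_Harris_core toyIS_Rogawski_core =
      toyInIS := rfl

end N41PlaceToy

/-! ### The universal chain and the joint toy's sides -/

namespace N41PlaceUniv

open N42ToyNSide

variable {ι : Type}

/-- The Langlands-class carriers on the universal chain's core: a pair is unramified iff it is `(a, a⁻¹)`, its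
Langlands class is `rep` of its first entry, LR's `BC(π_v) = (−1, (−1)⁻¹)`; `BC_lc` by the kernel algebra. -/
@[reducible] noncomputable def univLC (D : DoublingLDatum ι) (hS : ∀ v, v ∈ D.S) :
    LCDatum (univIn D hS).toData where
  unr := fun _ ρ => ρ.2 = ρ.1⁻¹
  π_unr := fun _ _ _ => rfl
  lc := fun _ ρ => rep ρ.1
  BC := fun _ => (-1, (-1)⁻¹)
  BCχ_def := fun _ _ => by simp [InertDatum.toData, univIn, univPl]
  BC_lc := fun _ _ _ a s hs hl => by
    have ha : a = -1 := eq_neg_one_of_twisted_conj_rep_neg_one a s hs hl.symm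
    subst ha
    exact Or.inl rfl

section univ

variable (D : DoublingLDatum ι) (hS : ∀ v, v ∈ D.S)

/-- Getz–Hahn §7.5–7.6 on the chain, by computation (not vacuous): a member of `JH 𝔓 a = {(a, a⁻¹)}` has
`lc ρ = rep a`, conjugator `s = 1`. -/
theorem univ_GH : Hyp.GetzHahn2024_Prop7_6_5 (univLC D hS) := by
  intro 𝔓 _ a ρ _ ha
  change ρ = (a, a⁻¹) at ha
  refine ⟨1, by simp, ?_⟩
  rw [one_twisted_conj]
  show rep ρ.1 = rep a
  rw [ha]

/-- The inert datum rebuilt from the chain's core and its Langlands-class carriers is `univIn D hS`. -/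
theorem univ_inertDatum_of_lc_eq :
    N41Place.inertDatum_of_lc (univIn D hS).toData (univLC D hS) (univ_GH D hS)
      (univ_Harris_core D hS) (univ_Rogawski_core D hS) = univIn D hS := rfl

include hS in
/-- **The placement (P7) composed on the chain through the Langlands-class cut.** -/
theorem univ_placement_kappa_lc : ∀ v ∉ D.S, ∀ s : ℂ, D.Lv v s = D.g₁ v s * D.g₂ v s :=
  N41Place.N41_placement_kappa_lc D (univPl D hS) (univIn D hS).toData (univLC D hS) (univ_GH D hS)
    (univ_Harris_core D hS) (univ_Rogawski_core D hS) (univSp D hS) (univLQ D hS) (univKd D hS)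
    (univ_LR7 D hS) (univ_Bump D hS) (univ_Minguez D hS) (univ_Bump451 D hS) (univ_Rao D hS)
    (univ_dich D hS) (univ_kappa' D hS)

end univ

/-- The Langlands-class carriers on `toyD41` (the core of the `InA` / `InB` slot). -/
@[reducible] noncomputable def d41LC : LCDatum d41In.toData := univLC toyD41 toyD41_S_all

/-- Getz–Hahn §7.5–7.6 on `toyD41` (by computation, not vacuous). -/
theorem d41_GH : Hyp.GetzHahn2024_Prop7_6_5 d41LC := univ_GH toyD41 toyD41_S_all

/-- The inert datum rebuilt on `toyD41` is `d41In`. -/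
theorem d41_inertDatum_of_lc_eq :
    N41Place.inertDatum_of_lc d41In.toData d41LC d41_GH d41_Harris_core d41_Rogawski_core = d41In := rfl

/-- The placement composed on `toyD41` through the Langlands-class cut. -/
theorem d41_placement_kappa_lc : ∀ v ∉ toyD41.S, ∀ s : ℂ, toyD41.Lv v s = toyD41.g₁ v s * toyD41.g₂ v s :=
  N41Place.N41_placement_kappa_lc toyD41 d41Pl d41In.toData d41LC d41_GH d41_Harris_core d41_Rogawski_core
    d41Sp d41LQ d41Kd d41_LR7 d41_Bump d41_Minguez d41_Bump451 d41_Rao d41_dich d41_kappa'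

/-- The same composition stated on `N43Toy.bergmanNSide.d41` (the joint toy's sides). -/
theorem bergman_d41_placement_kappa_lc : ∀ v ∉ N43Toy.bergmanNSide.d41.S, ∀ s : ℂ,
    N43Toy.bergmanNSide.d41.Lv v s = N43Toy.bergmanNSide.d41.g₁ v s * N43Toy.bergmanNSide.d41.g₂ v s :=
  N41Place.N41_placement_kappa_lc N43Toy.bergmanNSide.d41 d41Pl d41In.toData d41LC d41_GH d41_Harris_core
    d41_Rogawski_core d41Sp d41LQ d41Kd d41_LR7 d41_Bump d41_Minguez d41_Bump451 d41_Rao d41_dich d41_kappa'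

end N41PlaceUniv

end Summit.Ventures.HodgeRepro2.T6
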